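import Literature.MathematicalPhysics.QuantumFieldTheory.Balaban1983to89.B9CubeDirichletLetterClosedBox

/-!
# `Balaban1983to89.B9CubeDirichletLetterDerivAtOne` — [Balaban1985BackgroundPropagators] Thm 3.1 (3.42)₂,₃,₄ p. 397 AT `U = 1` FOR PRINT's DIRICHLET CUBE LETTER `G′_□(1)`:
# the forward difference `∂_μG′_□(1)`, the adjoint difference `G′_□(1)∂_μ*` and the Laplacian `(−Δ)G′_□(1)` have the block majorants `C·L^{j}·e^{−δd}`, `C·L^{j}·e^{−δd}`,
# `C·e^{−δd}` over the cube family's geometry — by the method of images ([Balaban1983RegularityDecay] (2.42) p. 584) from p33's window censuses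
# `prop22_second∕third∕sixth_multiLevelTorus` at the reflected cube family (ROAD (I) «IMAGES», file D3e-β2)

FRAMING (verbatim cell line):
statement-level skeleton of published theorems with citation tags; proofs where landed; nothing here is a claim about the Yang–Mills mass gap

Sources: T. Bałaban, *Propagators for lattice gauge theories in a background field*, Commun. Math. Phys. **99** (1985) 389–434 [`Balaban1985BackgroundPropagators`],
Thm 3.1 (3.42) p. 397 (entries 2–4: «|(∇^η_{U,x}G′(U)λ)(x)|, |(G′(U)∇^{η*}_Uλ)(x)|, |(Δ^η_UG′(U)λ)(x)| ≤ O(1)[L^jη, L^jη, 1]e^{−δd(y,y′)}|λ|»), Cor. 3.5 p. 407 («U = 1»), p. 394,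
p. 409 l. 1–5; T. Bałaban, *Propagators and renormalization transformations for lattice gauge theories. II*, Commun. Math. Phys. **96** (1984) 223–250
[`Balaban1984PropagatorsII`], Prop. 2.2 (2.67)₂,₃,₆ p. 234, (2.51) p. 232; T. Bałaban, *Regularity and decay of lattice Green's functions*, Commun. Math. Phys. **89** (1983)
571–597 [`Balaban1983RegularityDecay`], (2.42) p. 584 («Using this representation it is enough to prove (2.35), (2.36) for the propagator G_j»).  Unit
`pub-ymgap-dag-n06-c` (g31).

## WHAT THIS FILE CERTIFIES (kernel-checked; `η = 1`, `L = ℓ + 1`; `K = GpDirOne D q` the Dirichlet cube letter of D3c-β, `F = cubeFam D q`, weights `wCube`)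

* §1 THE ROWS: `dT_GpDirOne_row` (`(∂_μK f)(emb x) = Σ_ε (−1)^{#ε}((∂′_μG′)(f̃∘σ_ε))(x)` for `x, x + e_μ ∈ X̄` — SOURCE images), `dT_GpDirOne_row_eq_zero` (all other rows
  vanish); `GpDirOne_dTt_row` (`(K∂_μᵀ f)(emb x) = Σ_ε (−1)^{#ε}((G′∂′_μᵀ)f̃)(σ_ε x)`, `x ∈ X`, `f̃` the pull-back to `{y ∈ X̄ : y + e_μ ∈ X̄}` — TARGET images);
  `perLapT_GpDirOne_row` (`((−Δ)K f)(emb x) = Σ_ε (−1)^{#ε}(((−Δ′)G′)(f̃∘σ_ε))(x)`, `x ∈ X`); `lev_eq_zero_of_boundary_step` (a site of `Ω₀(□)` with a torus neighbour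
  off `Ω₀(□)` has cube level `0`: it sits next to a mirror, far outside `C₁(□)`);
* §2 ★★★ `hasMajorant_dT_GpDirOne` ((3.42)₂: `2^{d+1}·C·L^{j}·e^{−(δ₀/2)d}`), ★★★ `hasMajorant_GpDirOne_dTt` ((3.42)₃: same shape), ★★★ `hasMajorant_perLapT_GpDirOne`
  ((3.42)₄: `C′·e^{−(δ₀/2)d}`, the fold of `(−Δ′)G′` on the rows of `Ω₀(□)` PLUS the boundary-flux rows just outside `Ω₀(□)` — there `((−Δ)Kf)(z) = −Σ_{z′ ∼ z, z′ ∈ Ω₀}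
  (Kf)(z′)`, bounded by (3.42)₁ at level `0` one bond away) — the shapes of r05's `thm31_cubeW_flat_second∕third∕sixth` for the torus letter, i.e. the inputs
  `h₂, h₃` of `B9Cor35GpCubeInputsAtOne.h342_2_cube_inl ∕ h342_3_cube_inr` at the Dirichlet letter.

## HONEST SCOPE

`U = 1` and the sup entries only (no Hölder entries (3.43)–(3.47)); constants `×2^{d+1}` (the number of images) resp. `+ 2(d+1)·2^{d+1}C₁e^{δ₁/2}` (boundary flux) against
the torus letter's; thresholds the maxima of the censuses'.  Nothing continuum ∕ OS ∕ Clay; N06 is not discharged by this file; the YM mass gap is not proved by any of this.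
-/

namespace Literature.MathematicalPhysics.QuantumFieldTheory.Balaban1983to89.B9CubeDirichletLetterDerivAtOne

noncomputable section

open Finset
open scoped Matrix
open Literature.MathematicalPhysics.QuantumFieldTheory.Balaban1983to89.B4Reflection242 (boxDom mem_boxDom blk)
open Literature.MathematicalPhysics.QuantumFieldTheory.Balaban1983to89.B4TorusKernel.MultiPeriod (torusSupNorm)
open Literature.MathematicalPhysics.QuantumFieldTheory.Balaban1983to89.B6MultiLevelBoxOperator (N0 bigSide one_le_bigSide)
open Literature.MathematicalPhysics.QuantumFieldTheory.Balaban1983to89.B6MultiLevelTorusOperator (twrap tshift shiftMat unitVec mlOpT gmlT perLapT one_le_of_mem one_le_N0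
  tshift_val tshift_tshift tshift_zero perLapT_mulVec)
open Literature.MathematicalPhysics.QuantumFieldTheory.Balaban1983to89.B6MultiLevelTorusOperatorL0 (TDomains)
open Literature.MathematicalPhysics.QuantumFieldTheory.Balaban1983to89.B6Prop22DerivMultiLevelTorus (dT dT_mulVec)
open Literature.MathematicalPhysics.QuantumFieldTheory.Balaban1983to89.B6Cover236MultiLevelBlocks (cubes)
open Literature.MathematicalPhysics.QuantumFieldTheory.Balaban1983to89.B6Geom246MultiLevelBoxL0 (bset blkOf blkOf_val)
open Literature.MathematicalPhysics.QuantumFieldTheory.Balaban1983to89.B6Geom246MultiLevelTorusL0 (bondT bondT_adj connectedT geomT)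
open Literature.MathematicalPhysics.QuantumFieldTheory.Balaban1983to89.B6RandomWalk (HasMajorant BlockSupp hasMajorant_mono hasMajorant_add)
open Literature.MathematicalPhysics.QuantumFieldTheory.Balaban1983to89.B6Ineq243TwoLevelBox (aNext)
open Literature.MathematicalPhysics.QuantumFieldTheory.Balaban1983to89.B6Prop22DerivMultiLevelTorusL0 (prop22_second_multiLevelTorus)
open Literature.MathematicalPhysics.QuantumFieldTheory.Balaban1983to89.B6Prop22AdjMultiLevelTorusL0 (prop22_third_multiLevelTorus)
open Literature.MathematicalPhysics.QuantumFieldTheory.Balaban1983to89.B6Prop22LapMultiLevelTorusL0 (prop22_sixth_multiLevelTorus)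
open Literature.MathematicalPhysics.QuantumFieldTheory.Balaban1983to89.B9CubeSequence408 (cubeFam InC lev_cubeFam_eq_zero)
open Literature.MathematicalPhysics.QuantumFieldTheory.Balaban1983to89.B9Thm31CubeLocalFlat (wCube cCube wCube_pos wCube_window cCube_window wCube_rec amin_pos)
open Literature.MathematicalPhysics.QuantumFieldTheory.Balaban1983to89.B9Cor35ComparisonsGpCAtLetters (dT_transpose_mulVec)
open Literature.MathematicalPhysics.QuantumFieldTheory.Balaban1983to89.B4Eq242TorusMirrors
open Literature.MathematicalPhysics.QuantumFieldTheory.Balaban1983to89.B6MultiLevelTorusMirrorL0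
open Literature.MathematicalPhysics.QuantumFieldTheory.Balaban1983to89.B6MultiLevelTorusMirrorCompression
open Literature.MathematicalPhysics.QuantumFieldTheory.Balaban1983to89.B6MultiLevelTorusMirrorImageFold
open Literature.MathematicalPhysics.QuantumFieldTheory.Balaban1983to89.B9CubeSequence408Mirrors
open Literature.MathematicalPhysics.QuantumFieldTheory.Balaban1983to89.B9CubeDirichletLetterAtOne
open Literature.MathematicalPhysics.QuantumFieldTheory.Balaban1983to89.B9CubeDirichletLetterClosedBox

variable {d : ℕ}

section Rows

variable {ℓ Mh k R : ℕ} {P : Fin (d + 1) → ℕ} {D : B6MultiLevelTorusOperator.TDomains d ℓ Mh k P R} {q : ↥(cubes D.toDomains)}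
  {hL : Odd (ℓ + 1)} {hM : Odd Mh} {hMh : 1 ≤ Mh} {hP : ∀ μ, 1 ≤ P μ}

/-! ## §1  The rows of `∂_μK`, `K∂_μᵀ`, `(−Δ)K` at the embedded sites -/

/-- the row of `K` at an embedded closed-box site in source-image form: `(Kf)(emb x) = Σ_ε (−1)^{#ε}(G′(f̃_X ∘ σ_ε))(x)`.
[cite: Balaban1983RegularityDecay, (2.42) p.584; Balaban1985BackgroundPropagators, p.394] -/
theorem GpDirOne_mulVec_sourceImages (hℓ : 1 ≤ ℓ) {x : ↥(boxDom (NrefC q))} (hx : x ∈ closedC D q) (f : ↥(boxDom (N0 ℓ Mh k P)) → ℝ) :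
    (GpDirOne D q hL hM hMh hP *ᵥ f) (embCpt D q hMh hP x) =
      ∑ ε ∈ mirIdx (mirC q), tsign ℝ (mirC q) ε *
        (GrefC D q hL hM hMh hP *ᵥ (fun w => pullY (k := k) (P := P) hMh hP (gC q) (boxC D q) f (trefl (hmirC q hL hM hMh) ε w))) x := by
  rw [GpDirOne_mulVec_embCpt hℓ hx, ← sum_SIC_mul_eq_sourceImages]
  symm
  rw [← Finset.sum_subset (Finset.subset_univ (boxC D q)) (fun y _ hy => by rw [pullY_of_not_mem f hy, mul_zero])]
  exact Finset.sum_congr rfl fun y hy => by rw [pullY_of_mem f hy]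

/-- ★ **THE ROW OF `∂_μK`** at `emb x` for `x, x + e_μ ∈ X̄`: `(∂_μKf)(emb x) = Σ_ε (−1)^{#ε}((∂′_μG′)(f̃_X ∘ σ_ε))(x)` (the embedding intertwines `e_μ`; both rows of `K` in
source-image form). [cite: Balaban1985BackgroundPropagators, Thm 3.1 (3.42)₂ p.397; Balaban1983RegularityDecay, (2.42) p.584] -/
theorem dT_GpDirOne_row (hℓ : 1 ≤ ℓ) (μ : Fin (d + 1)) (f : ↥(boxDom (N0 ℓ Mh k P)) → ℝ) {x : ↥(boxDom (NrefC q))} (hx : x ∈ closedC D q)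
    (hx' : tshift (NrefC q) (unitVec μ) x ∈ closedC D q) :
    ((dT (N0 ℓ Mh k P) μ * GpDirOne D q hL hM hMh hP) *ᵥ f) (embCpt D q hMh hP x) =
      ∑ ε ∈ mirIdx (mirC q), tsign ℝ (mirC q) ε *
        ((dT (NrefC q) μ * GrefC D q hL hM hMh hP) *ᵥ (fun w => pullY (k := k) (P := P) hMh hP (gC q) (boxC D q) f (trefl (hmirC q hL hM hMh) ε w))) x := by
  rw [← Matrix.mulVec_mulVec, dT_mulVec, ← emb_tshift_unit_of_closed (hP := hP) hℓ hL hM hx (Or.inl rfl),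
    GpDirOne_mulVec_sourceImages hℓ hx', GpDirOne_mulVec_sourceImages hℓ hx, ← Finset.sum_sub_distrib]
  refine Finset.sum_congr rfl fun ε _ => ?_
  rw [← Matrix.mulVec_mulVec, dT_mulVec]; ring

/-- the rows of `∂_μK` not of the form `emb x`, `x, x + e_μ ∈ X̄`, VANISH. [cite: Balaban1985BackgroundPropagators, p.394 (Dirichlet rows), bookkeeping] -/
theorem dT_GpDirOne_row_eq_zero (hℓ : 1 ≤ ℓ) (μ : Fin (d + 1)) (f : ↥(boxDom (N0 ℓ Mh k P)) → ℝ) (z : ↥(boxDom (N0 ℓ Mh k P)))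
    (hz : ∀ x ∈ (closedC D q).filter (fun x => tshift (NrefC q) (unitVec μ) x ∈ closedC D q),
      B6MultiLevelTorusMirrorL0.emb (ℓ := ℓ) (Mh := Mh) (k := k) (P := P) (gC q) x.1 ≠ z.1) :
    ((dT (N0 ℓ Mh k P) μ * GpDirOne D q hL hM hMh hP) *ᵥ f) z = 0 := by
  rw [← Matrix.mulVec_mulVec, dT_mulVec]
  have h0 : (GpDirOne D q hL hM hMh hP *ᵥ f) z = 0 := by
    refine GpDirOne_mulVec_eq_zero (fun hmem => ?_) f
    obtain ⟨x, hx, he⟩ := (mem_dirDomC_iff hMh hP).1 hmem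
    exact hz x (Finset.mem_filter.2 ⟨mirBoxOpen_subset_closed hx, tshift_unit_mem_closedC hL hM hMh hx (Or.inl rfl)⟩) he
  have h1 : (GpDirOne D q hL hM hMh hP *ᵥ f) (tshift (N0 ℓ Mh k P) (unitVec μ) z) = 0 := by
    refine GpDirOne_mulVec_eq_zero (fun hmem => ?_) f
    obtain ⟨x₁, hx₁, he⟩ := (mem_dirDomC_iff hMh hP).1 hmem
    have hx₀ : tshift (NrefC q) (-unitVec μ) x₁ ∈ closedC D q := tshift_unit_mem_closedC hL hM hMh hx₁ (Or.inr rfl)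
    refine hz (tshift (NrefC q) (-unitVec μ) x₁) (Finset.mem_filter.2 ⟨hx₀, ?_⟩) ?_
    · rw [tshift_comp_neg_self]; exact mirBoxOpen_subset_closed hx₁
    · have e := emb_tshift_unit_of_closed (hMh := hMh) (hP := hP) hℓ hL hM (mirBoxOpen_subset_closed hx₁) (v := -unitVec μ) (μ := μ) (Or.inr rfl)
      have e1 : embCpt D q hMh hP x₁ = tshift (N0 ℓ Mh k P) (unitVec μ) z := Subtype.ext he
      rw [e1, tshift_neg_comp_self] at e
      exact congrArg Subtype.val e
  rw [h0, h1, sub_zero]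

/-- ★ **THE ROW OF `K∂_μᵀ`** at `emb x`, `x ∈ X`: `(K∂_μᵀ f)(emb x) = Σ_ε (−1)^{#ε}((G′∂′_μᵀ)f̃)(σ_ε x)` with `f̃` the pull-back of `f` to `Y = {y ∈ X̄ : y + e_μ ∈ X̄}` (TARGET images;
the columns on the mirrors vanish, the pull-back off `Y` kills the stray top layer). [cite: Balaban1985BackgroundPropagators, Thm 3.1 (3.42)₃ p.397; Balaban1983RegularityDecay, (2.42) p.584] -/
theorem GpDirOne_dTt_row (hℓ : 1 ≤ ℓ) (μ : Fin (d + 1)) (f : ↥(boxDom (N0 ℓ Mh k P)) → ℝ) {x : ↥(boxDom (NrefC q))} (hx : x ∈ boxC D q) :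
    ((GpDirOne D q hL hM hMh hP * (dT (N0 ℓ Mh k P) μ)ᵀ) *ᵥ f) (embCpt D q hMh hP x) =
      ∑ ε ∈ mirIdx (mirC q), tsign ℝ (mirC q) ε *
        ((GrefC D q hL hM hMh hP * (dT (NrefC q) μ)ᵀ) *ᵥ
          pullY (k := k) (P := P) hMh hP (gC q) ((closedC D q).filter (fun y => tshift (NrefC q) (unitVec μ) y ∈ closedC D q)) f)
          (trefl (hmirC q hL hM hMh) ε x) := by
  rw [← Matrix.mulVec_mulVec, GpDirOne_mulVec_embCpt hℓ (mirBoxOpen_subset_closed hx)]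
  -- on the open box the transposed difference of `f` at `emb y` is that of the pull-back `f̃` at `y`
  have hX : ∀ y ∈ boxC D q, ((dT (N0 ℓ Mh k P) μ)ᵀ *ᵥ f) (embCpt D q hMh hP y) =
      ((dT (NrefC q) μ)ᵀ *ᵥ pullY (k := k) (P := P) hMh hP (gC q) ((closedC D q).filter (fun y => tshift (NrefC q) (unitVec μ) y ∈ closedC D q)) f) y := by
    intro y hy
    have hyc := mirBoxOpen_subset_closed hy
    have hym : tshift (NrefC q) (-unitVec μ) y ∈ closedC D q := tshift_unit_mem_closedC hL hM hMh hy (Or.inr rfl)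
    have h1 : y ∈ (closedC D q).filter (fun y => tshift (NrefC q) (unitVec μ) y ∈ closedC D q) :=
      Finset.mem_filter.2 ⟨hyc, tshift_unit_mem_closedC hL hM hMh hy (Or.inl rfl)⟩
    have h2 : tshift (NrefC q) (-unitVec μ) y ∈ (closedC D q).filter (fun y => tshift (NrefC q) (unitVec μ) y ∈ closedC D q) :=
      Finset.mem_filter.2 ⟨hym, by rw [tshift_comp_neg_self]; exact hyc⟩
    rw [dT_transpose_mulVec, dT_transpose_mulVec, pullY_of_mem f h1, pullY_of_mem f h2,
      ← emb_tshift_unit_of_closed (hP := hP) hℓ hL hM hyc (Or.inr rfl)]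
  rw [Finset.sum_congr rfl fun y hy => by rw [hX y hy]]
  have hR : ∀ ε, ((GrefC D q hL hM hMh hP * (dT (NrefC q) μ)ᵀ) *ᵥ
      pullY (k := k) (P := P) hMh hP (gC q) ((closedC D q).filter (fun y => tshift (NrefC q) (unitVec μ) y ∈ closedC D q)) f) (trefl (hmirC q hL hM hMh) ε x) =
      (GrefC D q hL hM hMh hP *ᵥ ((dT (NrefC q) μ)ᵀ *ᵥ
        pullY (k := k) (P := P) hMh hP (gC q) ((closedC D q).filter (fun y => tshift (NrefC q) (unitVec μ) y ∈ closedC D q)) f)) (trefl (hmirC q hL hM hMh) ε x) := by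
    intro ε; rw [Matrix.mulVec_mulVec]
  have hRsum : (∑ ε ∈ mirIdx (mirC q), tsign ℝ (mirC q) ε * ((GrefC D q hL hM hMh hP * (dT (NrefC q) μ)ᵀ) *ᵥ
      pullY (k := k) (P := P) hMh hP (gC q) ((closedC D q).filter (fun y => tshift (NrefC q) (unitVec μ) y ∈ closedC D q)) f) (trefl (hmirC q hL hM hMh) ε x)) =
      ∑ ε ∈ mirIdx (mirC q), tsign ℝ (mirC q) ε * (GrefC D q hL hM hMh hP *ᵥ ((dT (NrefC q) μ)ᵀ *ᵥ
        pullY (k := k) (P := P) hMh hP (gC q) ((closedC D q).filter (fun y => tshift (NrefC q) (unitVec μ) y ∈ closedC D q)) f)) (trefl (hmirC q hL hM hMh) ε x) :=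
    Finset.sum_congr rfl fun ε _ => by rw [hR ε]
  rw [hRsum, ← sum_SIC_mul_eq_targetImages (D := D) (q := q) (hL := hL) (hM := hM) (hMh := hMh) (hP := hP) hℓ x
    ((dT (NrefC q) μ)ᵀ *ᵥ pullY (k := k) (P := P) hMh hP (gC q) ((closedC D q).filter (fun y => tshift (NrefC q) (unitVec μ) y ∈ closedC D q)) f)]
  -- off the open box: either a mirror column (`SI = 0`) or the datum vanishes
  have hvan : ∀ y ∈ (Finset.univ : Finset ↥(boxDom (NrefC q))), y ∉ boxC D q →
      SIC D q hL hM hMh hP x y * ((dT (NrefC q) μ)ᵀ *ᵥ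
        pullY (k := k) (P := P) hMh hP (gC q) ((closedC D q).filter (fun y => tshift (NrefC q) (unitVec μ) y ∈ closedC D q)) f) y = 0 := by
    intro y _ hy
    by_cases hyc : y ∈ closedC D q
    · rw [SIC_eq_zero_of_snd hyc hy, zero_mul]
    · have h1 : pullY (k := k) (P := P) hMh hP (gC q) ((closedC D q).filter (fun y => tshift (NrefC q) (unitVec μ) y ∈ closedC D q)) f y = 0 :=
        pullY_of_not_mem f (fun h => hyc (Finset.mem_filter.1 h).1)
      have h2 : pullY (k := k) (P := P) hMh hP (gC q) ((closedC D q).filter (fun y => tshift (NrefC q) (unitVec μ) y ∈ closedC D q)) f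
          (tshift (NrefC q) (-unitVec μ) y) = 0 := by
        refine pullY_of_not_mem f fun h => ?_
        have := (Finset.mem_filter.1 h).2
        rw [tshift_comp_neg_self] at this
        exact hyc this
      rw [dT_transpose_mulVec, h1, h2, sub_zero, mul_zero]
  rw [← Finset.sum_subset (Finset.subset_univ (boxC D q)) hvan]

/-- ★ **THE ROW OF `(−Δ)K`** at `emb x`, `x ∈ X`: `((−Δ)Kf)(emb x) = Σ_ε (−1)^{#ε}(((−Δ′)G′)(f̃_X ∘ σ_ε))(x)` (all `x ± e_μ ∈ X̄`).
[cite: Balaban1985BackgroundPropagators, Thm 3.1 (3.42)₄ p.397; Balaban1983RegularityDecay, (2.42) p.584] -/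
theorem perLapT_GpDirOne_row (hℓ : 1 ≤ ℓ) (f : ↥(boxDom (N0 ℓ Mh k P)) → ℝ) {x : ↥(boxDom (NrefC q))} (hx : x ∈ boxC D q) :
    ((perLapT (N0 ℓ Mh k P) * GpDirOne D q hL hM hMh hP) *ᵥ f) (embCpt D q hMh hP x) =
      ∑ ε ∈ mirIdx (mirC q), tsign ℝ (mirC q) ε *
        ((perLapT (NrefC q) * GrefC D q hL hM hMh hP) *ᵥ (fun w => pullY (k := k) (P := P) hMh hP (gC q) (boxC D q) f (trefl (hmirC q hL hM hMh) ε w))) x := by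
  have hxc := mirBoxOpen_subset_closed hx
  rw [← Matrix.mulVec_mulVec, perLapT_mulVec]
  have hμ : ∀ μ : Fin (d + 1), 2 * (GpDirOne D q hL hM hMh hP *ᵥ f) (embCpt D q hMh hP x) -
      (GpDirOne D q hL hM hMh hP *ᵥ f) (tshift (N0 ℓ Mh k P) (unitVec μ) (embCpt D q hMh hP x)) -
      (GpDirOne D q hL hM hMh hP *ᵥ f) (tshift (N0 ℓ Mh k P) (-unitVec μ) (embCpt D q hMh hP x)) =
      ∑ ε ∈ mirIdx (mirC q), tsign ℝ (mirC q) ε *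
        (2 * (GrefC D q hL hM hMh hP *ᵥ (fun w => pullY (k := k) (P := P) hMh hP (gC q) (boxC D q) f (trefl (hmirC q hL hM hMh) ε w))) x -
          (GrefC D q hL hM hMh hP *ᵥ (fun w => pullY (k := k) (P := P) hMh hP (gC q) (boxC D q) f (trefl (hmirC q hL hM hMh) ε w))) (tshift (NrefC q) (unitVec μ) x) -
          (GrefC D q hL hM hMh hP *ᵥ (fun w => pullY (k := k) (P := P) hMh hP (gC q) (boxC D q) f (trefl (hmirC q hL hM hMh) ε w))) (tshift (NrefC q) (-unitVec μ) x)) := by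
    intro μ
    rw [← emb_tshift_unit_of_closed (hP := hP) hℓ hL hM hxc (Or.inl rfl), ← emb_tshift_unit_of_closed (hP := hP) hℓ hL hM hxc (Or.inr rfl),
      GpDirOne_mulVec_sourceImages hℓ hxc, GpDirOne_mulVec_sourceImages hℓ (tshift_unit_mem_closedC hL hM hMh hx (Or.inl rfl)),
      GpDirOne_mulVec_sourceImages hℓ (tshift_unit_mem_closedC hL hM hMh hx (Or.inr rfl)), Finset.mul_sum, ← Finset.sum_sub_distrib, ← Finset.sum_sub_distrib]
    refine Finset.sum_congr rfl fun ε _ => ?_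
    ring
  rw [Finset.sum_congr rfl fun μ _ => hμ μ, Finset.sum_comm]
  refine Finset.sum_congr rfl fun ε _ => ?_
  rw [← Finset.mul_sum, ← Matrix.mulVec_mulVec, perLapT_mulVec]

/-- ★ **A SITE OF `Ω₀(□)` WITH A TORUS NEIGHBOUR OFF `Ω₀(□)` HAS CUBE LEVEL `0`** (it is the image of a site next to a mirror, whose coordinate `h + 1` or `h + n − 1` is outside the
window `[h + S_{k′}, h + n − S_{k′}]` of `C₁(□)`). [cite: Balaban1985BackgroundPropagators, p.408 («dist(Ω₀(□)ᶜ, □⁴) …»); Balaban1984PropagatorsII, (2.3) p.224 (Λ₀)] -/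
theorem lev_eq_zero_of_boundary_step (hℓ : 1 ≤ ℓ) {z : ↥(boxDom (N0 ℓ Mh k P))} (hz : z ∉ dirDomC D q hMh hP) {v : Fin (d + 1) → ℤ} {μ : Fin (d + 1)}
    (hv : v = unitVec μ ∨ v = -unitVec μ) (hz' : tshift (N0 ℓ Mh k P) v z ∈ dirDomC D q hMh hP) :
    (cubeFam D q hL hM hMh hP).lev (tshift (N0 ℓ Mh k P) v z).1 = 0 := by
  obtain ⟨x₁, hx₁, he⟩ := (mem_dirDomC_iff hMh hP).1 hz'
  have hnv : -v = unitVec μ ∨ -v = -unitVec μ := by rcases hv with h | h <;> rw [h] <;> simp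
  -- `z = emb x₀`, `x₀ = x₁ − v ∈ X̄ ∖ X`
  set x₀ := tshift (NrefC q) (-v) x₁ with hx₀
  have hx₀c : x₀ ∈ closedC D q := tshift_unit_mem_closedC hL hM hMh hx₁ hnv
  have hz0 : embCpt D q hMh hP x₀ = z := by
    rw [hx₀, emb_tshift_unit_of_closed (hP := hP) hℓ hL hM (mirBoxOpen_subset_closed hx₁) hnv, show embCpt D q hMh hP x₁ = tshift (N0 ℓ Mh k P) v z from Subtype.ext he,
      tshift_tshift, add_neg_cancel, tshift_zero]
  have hx₀o : x₀ ∉ boxC D q := fun h => hz (hz0 ▸ (embC D q hMh hP ⟨x₀, h⟩).2)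
  -- the mirrored direction along which `x₀` sits on a mirror is `μ`, and `x₁` is next to the mirror
  have hcoord := tshift_unit_val_of_closed (D := D) hℓ hL hM hMh hx₀c hv
  have hx1eq : tshift (NrefC q) v x₀ = x₁ := by rw [hx₀, tshift_tshift, neg_add_cancel, tshift_zero]
  have hx₀c' := hx₀c
  simp only [closedC, mirBoxClosed, Finset.mem_filter, Finset.mem_univ, true_and] at hx₀c'
  have hx₀o' : ¬ ∀ ν, mirC q ν = true → hMir ℓ Mh (kTop q) < x₀.1 ν ∧ x₀.1 ν < hMir ℓ Mh (kTop q) + nMir ℓ Mh (kTop q) (mC q) ν := by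
    intro hc; apply hx₀o
    simp only [boxC, mirBoxOpen, Finset.mem_filter, Finset.mem_univ, true_and]; exact hc
  obtain ⟨ν, hν'⟩ := not_forall.1 hx₀o'
  obtain ⟨hν, hνb⟩ := Classical.not_imp.1 hν'
  have hx₁o := hx₁
  simp only [boxC, mirBoxOpen, Finset.mem_filter, Finset.mem_univ, true_and] at hx₁o
  obtain ⟨h1, h2⟩ := hx₁o ν hν
  obtain ⟨h3, h4⟩ := hx₀c' ν hν
  have h5 := (hcoord ν hν).1
  rw [hx1eq] at h5
  have hvν : v ν = 1 ∨ v ν = -1 ∨ v ν = 0 := by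
    rcases hv with h | h <;> rw [h] <;> [rw [(unitVec_apply_cases μ ν).1]; rw [(unitVec_apply_cases μ ν).2]] <;> split_ifs <;> simp
  -- the level: `emb x₁ ∉ C₁(□)`
  rw [← he]
  refine lev_cubeFam_eq_zero (D := D) (q := q) (hL := hL) (hM := hM) (hMh := hMh) (hP := hP) fun hC => ?_
  obtain ⟨hw1, hw2⟩ := coord_window_of_InC hMh hP q hx₁ hC hν
  obtain ⟨hh1, hh2⟩ := mirror_room (D := D) hℓ hL hM hMh q ν
  have hs : 3 ≤ sTop ℓ Mh (kTop q) := by have := two_mul_hMir_add_one (ℓ := ℓ) (k' := kTop q) hL hM; omega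
  rcases hvν with h | h | h <;> rw [h] at h5 <;> omega

end Rows

/-! ## §2  Theorem 3.1 (3.42)₂,₃,₄ at `U = 1` for the Dirichlet cube letter -/

section Entries

/-- the side vector of the reflected cube family has `P′_μ ≥ 1` and `≥ 4`. [cite: Balaban1984PropagatorsII, (2.1) p.224, bookkeeping] -/
theorem Pref_boundsC {ℓ Mh k R : ℕ} {P : Fin (d + 1) → ℕ} {D : B6MultiLevelTorusOperator.TDomains d ℓ Mh k P R} (q : ↥(cubes D.toDomains))
    (hP : ∀ μ, 1 ≤ P μ) (hP4 : ∀ μ, 4 ≤ P μ) :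
    (∀ μ, 1 ≤ Pref ℓ k (kTop q) P (mirC q) (mC q) μ) ∧ (∀ μ, 4 ≤ Pref ℓ k (kTop q) P (mirC q) (mC q) μ) := by
  constructor <;> intro μ <;> unfold Pref <;> split_ifs with hμ
  · have := two_le_mC q μ hμ; omega
  · exact le_trans (hP μ) (Nat.le_mul_of_pos_left _ (Nat.pow_pos (Nat.succ_pos ℓ)))
  · have := two_le_mC q μ hμ; omega
  · exact le_trans (hP4 μ) (Nat.le_mul_of_pos_left _ (Nat.pow_pos (Nat.succ_pos ℓ)))

/-- ★★★ **THEOREM 3.1 (3.42)₂ AT `U = 1` FOR `G′_□(1)`**: every forward difference `∂_μG′_□(1)` has the block majorant `2^{d+1}·C·L^{j(y)}·e^{−(δ₀/2)d(y,y′)}` over the cube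
family's geometry (`prop22_second_multiLevelTorus` at the reflected cube family, folded along source images).
[cite: Balaban1985BackgroundPropagators, Thm 3.1 (3.42) p.397 (second entry) with Cor. 3.5 p.407 and p.409 l.1–5; Balaban1984PropagatorsII, Prop. 2.2 (2.67)₂ p.234; Balaban1983RegularityDecay, (2.42) p.584] -/
theorem hasMajorant_dT_GpDirOne (d ℓ : ℕ) (hℓ : 1 ≤ ℓ) :
    ∃ δ₀ C M₀ : ℝ, ∃ N₀ : ℕ, 0 < δ₀ ∧ 0 < C ∧ 0 < M₀ ∧ 0 < N₀ ∧
      ∀ {Mh k R : ℕ} {P : Fin (d + 1) → ℕ} (D : B6MultiLevelTorusOperator.TDomains d ℓ Mh k P R)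
        (q : ↥(cubes D.toDomains)) (hL : Odd (ℓ + 1)) (hM : Odd Mh) (hMh : 1 ≤ Mh) (hP : ∀ μ, 1 ≤ P μ),
        3 ≤ Mh → M₀ ≤ ((ℓ : ℝ) + 1) * Mh → 2 * (ℓ + 1) ≤ R → N₀ + 1 ≤ R * ((ℓ + 1) * Mh) → (∀ μ, 4 ≤ P μ) →
        ∀ μ : Fin (d + 1),
        HasMajorant (g := geomT (cubeFam D q hL hM hMh hP)) (blkOf (cubeFam D q hL hM hMh hP).toDomains)
          (Matrix.toLin' (dT (N0 ℓ Mh k P) μ * GpDirOne D q hL hM hMh hP))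
          (fun y y' => 2 ^ (d + 1) * C * ((ℓ : ℝ) + 1) ^ y.1.1 *
            Real.exp (-(δ₀ / 2 * (geomT (cubeFam D q hL hM hMh hP)).dist y y'))) := by
  obtain ⟨δ₀, C, M₀, N₀, hδ₀, hC, hM₀, hN₀, h⟩ :=
    prop22_second_multiLevelTorus d ℓ hℓ (1 - ((((ℓ : ℝ) + 1)) ^ 2)⁻¹) 1 1 (1 - ((((ℓ : ℝ) + 1)) ^ 2)⁻¹)⁻¹ (amin_pos hℓ) one_pos
  refine ⟨δ₀, C, M₀, N₀, hδ₀, hC, hM₀, hN₀, ?_⟩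
  intro Mh k R P D q hL hM hMh hP h3 hM0 hR hN0 hP4 μ
  classical
  obtain ⟨hP', hP4'⟩ := Pref_boundsC q hP hP4
  have hK' := h (kTop q) Mh R h3 hM0 hR hN0 _ hP' hP4' (reflC D q hL hM hMh hP) (wCube ℓ) (cCube ℓ) (wCube_window hℓ) (cCube_window hℓ) (wCube_rec hℓ) μ
  have hφ : ∀ j : ℕ, 0 ≤ C * ((ℓ : ℝ) + 1) ^ j := fun j => by positivity
  have hfold := hasMajorant_of_sourceImages (F := cubeFam D q hL hM hMh hP) (hL := hL) (hM := hM) (hMh := hMh) (hP := hP) (hk := kTop_le q)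
    (hlev := lev_cubeFam_le_kTop q) (hm := two_le_mC q) (hg := sTop_dvd_gC q) (fitC hMh q)
    ((closedC D q).filter (fun x => tshift (NrefC q) (unitVec μ) x ∈ closedC D q)) (boxC D q)
    (fun x hx => (Finset.mem_filter.1 hx).1) (fun y hy => mirBoxOpen_subset_closed hy)
    (dT (NrefC q) μ * GrefC D q hL hM hMh hP) (φ := fun j => C * ((ℓ : ℝ) + 1) ^ j) hφ (δ := δ₀ / 2) (by positivity) hK'
    (Matrix.toLin' (dT (N0 ℓ Mh k P) μ * GpDirOne D q hL hM hMh hP))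
    (fun f z hz => by rw [Matrix.toLin'_apply]; exact dT_GpDirOne_row_eq_zero hℓ μ f z hz)
    (fun f x hx => by rw [Matrix.toLin'_apply]; exact dT_GpDirOne_row hℓ μ f (Finset.mem_filter.1 hx).1 (Finset.mem_filter.1 hx).2)
  refine hasMajorant_mono (g := geomT (cubeFam D q hL hM hMh hP)) _ hfold fun a b => ?_
  have hc := card_mirIdx_le (mirC q)
  have h0 : 0 ≤ C * ((ℓ : ℝ) + 1) ^ a.1.1 := hφ _
  have := mul_le_mul_of_nonneg_right hc h0
  have hexp := Real.exp_nonneg (-(δ₀ / 2 * (geomT (cubeFam D q hL hM hMh hP)).dist a b))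
  nlinarith

/-- ★★★ **THEOREM 3.1 (3.42)₃ AT `U = 1` FOR `G′_□(1)`**: every `G′_□(1)∂_μᵀ` has the block majorant `2^{d+1}·C·L^{j(y)}·e^{−(δ₀/2)d(y,y′)}` (`prop22_third_multiLevelTorus` at
the reflected cube family, folded along TARGET images). [cite: Balaban1985BackgroundPropagators, Thm 3.1 (3.42) p.397 (third entry) with Cor. 3.5 p.407 and p.409 l.1–5; Balaban1984PropagatorsII, Prop. 2.2 (2.67)₃ p.234; Balaban1983RegularityDecay, (2.42) p.584] -/
theorem hasMajorant_GpDirOne_dTt (d ℓ : ℕ) (hℓ : 1 ≤ ℓ) :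
    ∃ δ₀ C M₀ : ℝ, ∃ N₀ : ℕ, 0 < δ₀ ∧ 0 < C ∧ 0 < M₀ ∧ 0 < N₀ ∧
      ∀ {Mh k R : ℕ} {P : Fin (d + 1) → ℕ} (D : B6MultiLevelTorusOperator.TDomains d ℓ Mh k P R)
        (q : ↥(cubes D.toDomains)) (hL : Odd (ℓ + 1)) (hM : Odd Mh) (hMh : 1 ≤ Mh) (hP : ∀ μ, 1 ≤ P μ),
        3 ≤ Mh → M₀ ≤ ((ℓ : ℝ) + 1) * Mh → 2 * (ℓ + 1) ≤ R → N₀ + 1 ≤ R * ((ℓ + 1) * Mh) → (∀ μ, 4 ≤ P μ) →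
        ∀ μ : Fin (d + 1),
        HasMajorant (g := geomT (cubeFam D q hL hM hMh hP)) (blkOf (cubeFam D q hL hM hMh hP).toDomains)
          (Matrix.toLin' (GpDirOne D q hL hM hMh hP * (dT (N0 ℓ Mh k P) μ)ᵀ))
          (fun y y' => 2 ^ (d + 1) * C * ((ℓ : ℝ) + 1) ^ y.1.1 *
            Real.exp (-(δ₀ / 2 * (geomT (cubeFam D q hL hM hMh hP)).dist y y'))) := by
  obtain ⟨δ₀, C, M₀, N₀, hδ₀, hC, hM₀, hN₀, h⟩ :=
    prop22_third_multiLevelTorus d ℓ hℓ (1 - ((((ℓ : ℝ) + 1)) ^ 2)⁻¹) 1 1 (1 - ((((ℓ : ℝ) + 1)) ^ 2)⁻¹)⁻¹ (amin_pos hℓ) one_pos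
  refine ⟨δ₀, C, M₀, N₀, hδ₀, hC, hM₀, hN₀, ?_⟩
  intro Mh k R P D q hL hM hMh hP h3 hM0 hR hN0 hP4 μ
  classical
  obtain ⟨hP', hP4'⟩ := Pref_boundsC q hP hP4
  have hK' := h (kTop q) Mh R h3 hM0 hR hN0 _ hP' hP4' (reflC D q hL hM hMh hP) (wCube ℓ) (cCube ℓ) (wCube_window hℓ) (cCube_window hℓ) (wCube_rec hℓ) μ
  have hφ : ∀ j : ℕ, 0 ≤ C * ((ℓ : ℝ) + 1) ^ j := fun j => by positivity
  have hfold := hasMajorant_of_targetImages (F := cubeFam D q hL hM hMh hP) (hL := hL) (hM := hM) (hMh := hMh) (hP := hP) (hk := kTop_le q)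
    (hlev := lev_cubeFam_le_kTop q) (hm := two_le_mC q) (hg := sTop_dvd_gC q) (fitC hMh q)
    (boxC D q) ((closedC D q).filter (fun y => tshift (NrefC q) (unitVec μ) y ∈ closedC D q))
    (fun x hx => mirBoxOpen_subset_closed hx) (fun y hy => (Finset.mem_filter.1 hy).1)
    (GrefC D q hL hM hMh hP * (dT (NrefC q) μ)ᵀ) (φ := fun j => C * ((ℓ : ℝ) + 1) ^ j) hφ (δ := δ₀ / 2) (by positivity) hK'
    (Matrix.toLin' (GpDirOne D q hL hM hMh hP * (dT (N0 ℓ Mh k P) μ)ᵀ))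
    (fun f z hz => by
      rw [Matrix.toLin'_apply, ← Matrix.mulVec_mulVec]
      refine GpDirOne_mulVec_eq_zero (fun hmem => ?_) _
      obtain ⟨x, hx, he⟩ := (mem_dirDomC_iff hMh hP).1 hmem
      exact hz x hx he)
    (fun f x hx => by rw [Matrix.toLin'_apply]; exact GpDirOne_dTt_row hℓ μ f hx)
  refine hasMajorant_mono (g := geomT (cubeFam D q hL hM hMh hP)) _ hfold fun a b => ?_
  have hc := card_mirIdx_le (mirC q)
  have h0 : 0 ≤ C * ((ℓ : ℝ) + 1) ^ a.1.1 := hφ _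
  have := mul_le_mul_of_nonneg_right hc h0
  have hexp := Real.exp_nonneg (-(δ₀ / 2 * (geomT (cubeFam D q hL hM hMh hP)).dist a b))
  nlinarith

/-- ★★★ **THEOREM 3.1 (3.42)₄ AT `U = 1` FOR `G′_□(1)`**: `(−Δ)G′_□(1)` has the block majorant `C·e^{−(δ₀/2)d(y,y′)}` — on the rows of `Ω₀(□)` the fold of
`prop22_sixth_multiLevelTorus` at the reflected cube family; on the rows just outside `Ω₀(□)` (the embedded mirrors) the boundary flux `−Σ(Kf)(z ± e_μ)`, bounded by (3.42)₁
(`hasMajorant_GpDirOne`) at level `0` one bond away; all other rows vanish.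
[cite: Balaban1985BackgroundPropagators, Thm 3.1 (3.42) p.397 (fourth entry) with Cor. 3.5 p.407 and p.409 l.1–5, p.394 (Dirichlet rows); Balaban1984PropagatorsII, Prop. 2.2 (2.67)₆ p.234; Balaban1983RegularityDecay, (2.42) p.584] -/
theorem hasMajorant_perLapT_GpDirOne (d ℓ : ℕ) (hℓ : 1 ≤ ℓ) :
    ∃ δ₀ C M₀ : ℝ, ∃ N₀ : ℕ, 0 < δ₀ ∧ 0 < C ∧ 0 < M₀ ∧ 0 < N₀ ∧
      ∀ {Mh k R : ℕ} {P : Fin (d + 1) → ℕ} (D : B6MultiLevelTorusOperator.TDomains d ℓ Mh k P R)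
        (q : ↥(cubes D.toDomains)) (hL : Odd (ℓ + 1)) (hM : Odd Mh) (hMh : 1 ≤ Mh) (hP : ∀ μ, 1 ≤ P μ),
        3 ≤ Mh → M₀ ≤ ((ℓ : ℝ) + 1) * Mh → 2 * (ℓ + 1) ≤ R → N₀ + 1 ≤ R * ((ℓ + 1) * Mh) → (∀ μ, 4 ≤ P μ) →
        HasMajorant (g := geomT (cubeFam D q hL hM hMh hP)) (blkOf (cubeFam D q hL hM hMh hP).toDomains)
          (Matrix.toLin' (perLapT (N0 ℓ Mh k P) * GpDirOne D q hL hM hMh hP))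
          (fun y y' => C * Real.exp (-(δ₀ / 2 * (geomT (cubeFam D q hL hM hMh hP)).dist y y'))) := by
  obtain ⟨δa, Ca, Ma, Na, hδa, hCa, hMa, hNa, ha⟩ :=
    prop22_sixth_multiLevelTorus d ℓ hℓ (1 - ((((ℓ : ℝ) + 1)) ^ 2)⁻¹) 1 1 (1 - ((((ℓ : ℝ) + 1)) ^ 2)⁻¹)⁻¹ (amin_pos hℓ) one_pos
  obtain ⟨δb, Cb, Mb, Nb, hδb, hCb, hMb, hNb, hb⟩ := hasMajorant_GpDirOne d ℓ hℓ
  refine ⟨min δa δb, 2 ^ (d + 1) * Ca + 2 * (d + 1) * (2 ^ (d + 1) * Cb) * Real.exp (δb / 2), max Ma Mb, max Na Nb,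
    lt_min hδa hδb, by positivity, lt_max_of_lt_left hMa, lt_max_of_lt_left hNa, ?_⟩
  intro Mh k R P D q hL hM hMh hP h3 hM0 hR hN0 hP4
  classical
  have hM0a : Ma ≤ ((ℓ : ℝ) + 1) * Mh := le_trans (le_max_left _ _) hM0
  have hM0b : Mb ≤ ((ℓ : ℝ) + 1) * Mh := le_trans (le_max_right _ _) hM0
  have hN0a : Na + 1 ≤ R * ((ℓ + 1) * Mh) := le_trans (Nat.succ_le_succ (le_max_left _ _)) hN0
  have hN0b : Nb + 1 ≤ R * ((ℓ + 1) * Mh) := le_trans (Nat.succ_le_succ (le_max_right _ _)) hN0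
  obtain ⟨hP', hP4'⟩ := Pref_boundsC q hP hP4
  have hK' := ha (kTop q) Mh R h3 hM0a hR hN0a _ hP' hP4' (reflC D q hL hM hMh hP) (wCube ℓ) (cCube ℓ) (wCube_window hℓ) (cCube_window hℓ) (wCube_rec hℓ)
  have hK1 := hb D q hL hM hMh hP h3 hM0b hR hN0b hP4
  -- the split of `(−Δ)K` into the rows of `Ω₀(□)` and the rows off it
  set χ : ↥(boxDom (N0 ℓ Mh k P)) → ℝ := fun z => if z ∈ dirDomC D q hMh hP then 1 else 0 with hχ
  set Tin := Matrix.toLin' (Matrix.diagonal χ * (perLapT (N0 ℓ Mh k P) * GpDirOne D q hL hM hMh hP)) with hTin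
  set Tout := Matrix.toLin' (Matrix.diagonal (fun z => 1 - χ z) * (perLapT (N0 ℓ Mh k P) * GpDirOne D q hL hM hMh hP)) with hTout
  have hsplit : Matrix.toLin' (perLapT (N0 ℓ Mh k P) * GpDirOne D q hL hM hMh hP) = Tin + Tout := by
    have : (fun z => χ z + (1 - χ z)) = fun _ => (1 : ℝ) := funext fun z => by ring
    rw [hTin, hTout, ← map_add, ← Matrix.add_mul, Matrix.diagonal_add, this, Matrix.diagonal_one, Matrix.one_mul]
  have hTin_apply : ∀ f z, Tin f z = χ z * ((perLapT (N0 ℓ Mh k P) * GpDirOne D q hL hM hMh hP) *ᵥ f) z := by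
    intro f z; rw [hTin, Matrix.toLin'_apply, ← Matrix.mulVec_mulVec, Matrix.mulVec_diagonal]
  have hTout_apply : ∀ f z, Tout f z = (1 - χ z) * ((perLapT (N0 ℓ Mh k P) * GpDirOne D q hL hM hMh hP) *ᵥ f) z := by
    intro f z; rw [hTout, Matrix.toLin'_apply, ← Matrix.mulVec_mulVec, Matrix.mulVec_diagonal]
  -- (i) the rows of `Ω₀(□)`: the fold
  have hin : HasMajorant (g := geomT (cubeFam D q hL hM hMh hP)) (blkOf (cubeFam D q hL hM hMh hP).toDomains) Tin
      (fun y y' => (mirIdx (mirC q)).card * Ca * Real.exp (-(δa / 2 * (geomT (cubeFam D q hL hM hMh hP)).dist y y'))) := by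
    have hφ : ∀ _j : ℕ, 0 ≤ Ca := fun _ => hCa.le
    exact hasMajorant_of_sourceImages (F := cubeFam D q hL hM hMh hP) (hL := hL) (hM := hM) (hMh := hMh) (hP := hP) (hk := kTop_le q)
      (hlev := lev_cubeFam_le_kTop q) (hm := two_le_mC q) (hg := sTop_dvd_gC q) (fitC hMh q)
      (boxC D q) (boxC D q) (fun x hx => mirBoxOpen_subset_closed hx) (fun y hy => mirBoxOpen_subset_closed hy)
      (perLapT (NrefC q) * GrefC D q hL hM hMh hP) (φ := fun _ => Ca) hφ (δ := δa / 2) (by positivity) hK' Tin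
      (fun f z hz => by
        rw [hTin_apply]
        have : χ z = 0 := by
          rw [hχ]; simp only
          rw [if_neg]
          intro hmem
          obtain ⟨x, hx, he⟩ := (mem_dirDomC_iff hMh hP).1 hmem
          exact hz x hx he
        rw [this, zero_mul])
      (fun f x hx => by
        rw [hTin_apply]
        have hmem : embCpt D q hMh hP x ∈ dirDomC D q hMh hP := (embC D q hMh hP ⟨x, hx⟩).2
        have : χ (embCpt D q hMh hP x) = 1 := by rw [hχ]; simp only; rw [if_pos hmem]
        rw [this, one_mul]
        exact perLapT_GpDirOne_row hℓ f hx)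
  -- (ii) the rows off `Ω₀(□)`: the boundary flux, bounded by (3.42)₁ at level `0` one bond away
  have hout : HasMajorant (g := geomT (cubeFam D q hL hM hMh hP)) (blkOf (cubeFam D q hL hM hMh hP).toDomains) Tout
      (fun y y' => 2 * (d + 1) * (2 ^ (d + 1) * Cb) * Real.exp (δb / 2) * Real.exp (-(δb / 2 * (geomT (cubeFam D q hL hM hMh hP)).dist y y'))) := by
    intro y' f B hf z
    rw [hTout_apply]
    by_cases hz : z ∈ dirDomC D q hMh hP
    · have : 1 - χ z = 0 := by rw [hχ]; simp only; rw [if_pos hz]; ring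
      rw [this, zero_mul, abs_zero]
      exact mul_nonneg (mul_nonneg (by positivity) (Real.exp_nonneg _)) hf.nonneg
    have hχ0 : 1 - χ z = 1 := by rw [hχ]; simp only; rw [if_neg hz]; ring
    rw [hχ0, one_mul, ← Matrix.mulVec_mulVec, perLapT_mulVec, GpDirOne_mulVec_eq_zero hz]
    -- each neighbour term
    have hterm : ∀ (v : Fin (d + 1) → ℤ) (μ : Fin (d + 1)), (v = unitVec μ ∨ v = -unitVec μ) →
        |(GpDirOne D q hL hM hMh hP *ᵥ f) (tshift (N0 ℓ Mh k P) v z)| ≤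
          2 ^ (d + 1) * Cb * Real.exp (δb / 2) * Real.exp (-(δb / 2 * (geomT (cubeFam D q hL hM hMh hP)).dist (blkOf (cubeFam D q hL hM hMh hP).toDomains z) y')) * B := by
      intro v μ hv
      by_cases hz' : tshift (N0 ℓ Mh k P) v z ∈ dirDomC D q hMh hP
      · have h1 := hK1 y' f B hf (tshift (N0 ℓ Mh k P) v z)
        rw [Matrix.toLin'_apply] at h1
        have hl0 : (blkOf (cubeFam D q hL hM hMh hP).toDomains (tshift (N0 ℓ Mh k P) v z)).1.1 = 0 := by
          rw [blkOf_val]; exact lev_eq_zero_of_boundary_step (hL := hL) (hM := hM) hℓ hz hv hz'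
        dsimp only at h1
        rw [hl0, mul_zero, pow_zero, mul_one] at h1
        refine h1.trans ?_
        -- one bond: `d(blk z, y′) ≤ 1 + d(blk(z ± e_μ), y′)`
        have hconn : (bondT (cubeFam D q hL hM hMh hP)).Connected := connectedT hMh hP
        have hadj : (bondT (cubeFam D q hL hM hMh hP)).dist (blkOf (cubeFam D q hL hM hMh hP).toDomains z)
            (blkOf (cubeFam D q hL hM hMh hP).toDomains (tshift (N0 ℓ Mh k P) v z)) ≤ 1 := by
          by_cases he : blkOf (cubeFam D q hL hM hMh hP).toDomains z = blkOf (cubeFam D q hL hM hMh hP).toDomains (tshift (N0 ℓ Mh k P) v z)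
          · rw [he, SimpleGraph.dist_self]; exact Nat.zero_le _
          · have : (bondT (cubeFam D q hL hM hMh hP)).Adj (blkOf (cubeFam D q hL hM hMh hP).toDomains z)
                (blkOf (cubeFam D q hL hM hMh hP).toDomains (tshift (N0 ℓ Mh k P) v z)) :=
              bondT_adj.2 ⟨he, z, tshift (N0 ℓ Mh k P) v z, rfl, rfl,
                B6MultiLevelTorusMirrorDirichlet.torusSupNorm_sub_le_one_of_neighbour (μ := μ) (by rcases hv with rfl | rfl <;> [exact Or.inl rfl; exact Or.inr rfl])⟩
            rw [SimpleGraph.dist_eq_one_iff_adj.2 this]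
        have htri := hconn.dist_triangle (u := blkOf (cubeFam D q hL hM hMh hP).toDomains z)
          (v := blkOf (cubeFam D q hL hM hMh hP).toDomains (tshift (N0 ℓ Mh k P) v z)) (w := y')
        have hd : (geomT (cubeFam D q hL hM hMh hP)).dist (blkOf (cubeFam D q hL hM hMh hP).toDomains z) y' ≤
            1 + (geomT (cubeFam D q hL hM hMh hP)).dist (blkOf (cubeFam D q hL hM hMh hP).toDomains (tshift (N0 ℓ Mh k P) v z)) y' := by
          show ((bondT (cubeFam D q hL hM hMh hP)).dist _ y' : ℝ) ≤ 1 + ((bondT (cubeFam D q hL hM hMh hP)).dist _ y' : ℝ)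
          have : ((bondT (cubeFam D q hL hM hMh hP)).dist (blkOf (cubeFam D q hL hM hMh hP).toDomains z) y' : ℝ) ≤
              ((bondT (cubeFam D q hL hM hMh hP)).dist (blkOf (cubeFam D q hL hM hMh hP).toDomains z) (blkOf (cubeFam D q hL hM hMh hP).toDomains (tshift (N0 ℓ Mh k P) v z)) : ℝ) +
              ((bondT (cubeFam D q hL hM hMh hP)).dist (blkOf (cubeFam D q hL hM hMh hP).toDomains (tshift (N0 ℓ Mh k P) v z)) y' : ℝ) := by
            exact_mod_cast htri
          have h1' : ((bondT (cubeFam D q hL hM hMh hP)).dist (blkOf (cubeFam D q hL hM hMh hP).toDomains z) (blkOf (cubeFam D q hL hM hMh hP).toDomains (tshift (N0 ℓ Mh k P) v z)) : ℝ) ≤ 1 := by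
            exact_mod_cast hadj
          linarith
        have hexp : Real.exp (-(δb / 2 * (geomT (cubeFam D q hL hM hMh hP)).dist (blkOf (cubeFam D q hL hM hMh hP).toDomains (tshift (N0 ℓ Mh k P) v z)) y')) ≤
            Real.exp (δb / 2) * Real.exp (-(δb / 2 * (geomT (cubeFam D q hL hM hMh hP)).dist (blkOf (cubeFam D q hL hM hMh hP).toDomains z) y')) := by
          rw [← Real.exp_add]
          apply Real.exp_le_exp.2
          have := mul_le_mul_of_nonneg_left hd (show 0 ≤ δb / 2 by positivity)
          linarith
        have h0 : 0 ≤ 2 ^ (d + 1) * Cb := by positivity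
        calc 2 ^ (d + 1) * Cb * Real.exp (-(δb / 2 * (geomT (cubeFam D q hL hM hMh hP)).dist (blkOf (cubeFam D q hL hM hMh hP).toDomains (tshift (N0 ℓ Mh k P) v z)) y')) * B
            ≤ 2 ^ (d + 1) * Cb * (Real.exp (δb / 2) * Real.exp (-(δb / 2 * (geomT (cubeFam D q hL hM hMh hP)).dist (blkOf (cubeFam D q hL hM hMh hP).toDomains z) y'))) * B :=
              mul_le_mul_of_nonneg_right (mul_le_mul_of_nonneg_left hexp h0) hf.nonneg
          _ = _ := by ring
      · rw [GpDirOne_mulVec_eq_zero hz', abs_zero]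
        exact mul_nonneg (mul_nonneg (by positivity) (Real.exp_nonneg _)) hf.nonneg
    -- sum over the `2(d+1)` neighbours
    set E := 2 ^ (d + 1) * Cb * Real.exp (δb / 2) * Real.exp (-(δb / 2 * (geomT (cubeFam D q hL hM hMh hP)).dist (blkOf (cubeFam D q hL hM hMh hP).toDomains z) y')) * B with hE
    calc |∑ μ : Fin (d + 1), (2 * 0 - (GpDirOne D q hL hM hMh hP *ᵥ f) (tshift (N0 ℓ Mh k P) (unitVec μ) z) -
          (GpDirOne D q hL hM hMh hP *ᵥ f) (tshift (N0 ℓ Mh k P) (-unitVec μ) z))|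
        ≤ ∑ μ : Fin (d + 1), |2 * 0 - (GpDirOne D q hL hM hMh hP *ᵥ f) (tshift (N0 ℓ Mh k P) (unitVec μ) z) -
          (GpDirOne D q hL hM hMh hP *ᵥ f) (tshift (N0 ℓ Mh k P) (-unitVec μ) z)| := Finset.abs_sum_le_sum_abs _ _
      _ ≤ ∑ _μ : Fin (d + 1), (E + E) := by
          refine Finset.sum_le_sum fun μ _ => ?_
          rw [mul_zero, zero_sub]
          calc |-(GpDirOne D q hL hM hMh hP *ᵥ f) (tshift (N0 ℓ Mh k P) (unitVec μ) z) - (GpDirOne D q hL hM hMh hP *ᵥ f) (tshift (N0 ℓ Mh k P) (-unitVec μ) z)|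
              ≤ |-(GpDirOne D q hL hM hMh hP *ᵥ f) (tshift (N0 ℓ Mh k P) (unitVec μ) z)| + |(GpDirOne D q hL hM hMh hP *ᵥ f) (tshift (N0 ℓ Mh k P) (-unitVec μ) z)| :=
                abs_sub _ _
            _ ≤ E + E := by rw [abs_neg]; exact add_le_add (hterm _ μ (Or.inl rfl)) (hterm _ μ (Or.inr rfl))
      _ = 2 * (d + 1) * (2 ^ (d + 1) * Cb) * Real.exp (δb / 2) *
          Real.exp (-(δb / 2 * (geomT (cubeFam D q hL hM hMh hP)).dist (blkOf (cubeFam D q hL hM hMh hP).toDomains z) y')) * B := by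
          rw [Finset.sum_const, Finset.card_univ, Fintype.card_fin, nsmul_eq_mul, hE]; push_cast; ring
  -- assemble
  rw [hsplit]
  refine hasMajorant_mono (g := geomT (cubeFam D q hL hM hMh hP)) _ (hasMajorant_add _ hin hout) fun a b => ?_
  have hc := card_mirIdx_le (mirC q)
  have hda : Real.exp (-(δa / 2 * (geomT (cubeFam D q hL hM hMh hP)).dist a b)) ≤ Real.exp (-(min δa δb / 2 * (geomT (cubeFam D q hL hM hMh hP)).dist a b)) := by
    apply Real.exp_le_exp.2
    have hd0 : 0 ≤ (geomT (cubeFam D q hL hM hMh hP)).dist a b := by show (0 : ℝ) ≤ ((bondT _).dist a b : ℕ); positivity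
    have := mul_le_mul_of_nonneg_right (min_le_left δa δb) hd0
    linarith
  have hdb : Real.exp (-(δb / 2 * (geomT (cubeFam D q hL hM hMh hP)).dist a b)) ≤ Real.exp (-(min δa δb / 2 * (geomT (cubeFam D q hL hM hMh hP)).dist a b)) := by
    apply Real.exp_le_exp.2
    have hd0 : 0 ≤ (geomT (cubeFam D q hL hM hMh hP)).dist a b := by show (0 : ℝ) ≤ ((bondT _).dist a b : ℕ); positivity
    have := mul_le_mul_of_nonneg_right (min_le_right δa δb) hd0
    linarith
  have h1 : (mirIdx (mirC q)).card * Ca * Real.exp (-(δa / 2 * (geomT (cubeFam D q hL hM hMh hP)).dist a b)) ≤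
      2 ^ (d + 1) * Ca * Real.exp (-(min δa δb / 2 * (geomT (cubeFam D q hL hM hMh hP)).dist a b)) :=
    mul_le_mul (mul_le_mul_of_nonneg_right hc hCa.le) hda (Real.exp_nonneg _) (by positivity)
  have h2 : 2 * (d + 1) * (2 ^ (d + 1) * Cb) * Real.exp (δb / 2) * Real.exp (-(δb / 2 * (geomT (cubeFam D q hL hM hMh hP)).dist a b)) ≤
      2 * (d + 1) * (2 ^ (d + 1) * Cb) * Real.exp (δb / 2) * Real.exp (-(min δa δb / 2 * (geomT (cubeFam D q hL hM hMh hP)).dist a b)) :=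
    mul_le_mul_of_nonneg_left hdb (by positivity)
  calc (mirIdx (mirC q)).card * Ca * Real.exp (-(δa / 2 * (geomT (cubeFam D q hL hM hMh hP)).dist a b)) +
        2 * (d + 1) * (2 ^ (d + 1) * Cb) * Real.exp (δb / 2) * Real.exp (-(δb / 2 * (geomT (cubeFam D q hL hM hMh hP)).dist a b))
      ≤ 2 ^ (d + 1) * Ca * Real.exp (-(min δa δb / 2 * (geomT (cubeFam D q hL hM hMh hP)).dist a b)) +
        2 * (d + 1) * (2 ^ (d + 1) * Cb) * Real.exp (δb / 2) * Real.exp (-(min δa δb / 2 * (geomT (cubeFam D q hL hM hMh hP)).dist a b)) := add_le_add h1 h2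
    _ = (2 ^ (d + 1) * Ca + 2 * (d + 1) * (2 ^ (d + 1) * Cb) * Real.exp (δb / 2)) *
        Real.exp (-(min δa δb / 2 * (geomT (cubeFam D q hL hM hMh hP)).dist a b)) := by ring

end Entries

end

end Literature.MathematicalPhysics.QuantumFieldTheory.Balaban1983to89.B9CubeDirichletLetterDerivAtOne
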